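import Mathlib
import HarnessLib
import Summits.CriticalPhenomena.CardyFormulaZ2.Theses.CardyComplexCone
import Summits.CriticalPhenomena.CardyFormulaZ2.Theorems.CardyComplexConeEdgeCoherenceDefs
import Summits.CriticalPhenomena.CardyFormulaZ2.Theorems.CardyComplexConeEdgeCoherenceStubAliasing
import Summits.CriticalPhenomena.CardyFormulaZ2.Theorems.CardyComplexConeEdgeCoherenceLeeYangDefs
import Summits.CriticalPhenomena.CardyFormulaZ2.Theorems.CardyComplexConeEdgeCoherenceLeeYangLaurent
import Summits.CriticalPhenomena.CardyFormulaZ2.Theorems.CardyComplexConeEdgeCoherenceLeeYangIdentification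
import Summits.CriticalPhenomena.CardyFormulaZ2.Theorems.CardyComplexConeEdgeCoherenceLeeYangDivision
import Summits.CriticalPhenomena.CardyFormulaZ2.Theorems.CardyComplexConeEdgeCoherenceLeeYangTransfer
import Summits.CriticalPhenomena.CardyFormulaZ2.Theorems.CardyComplexConeEdgeCoherenceLeeYangStructure
import Summits.CriticalPhenomena.CardyFormulaZ2.Theorems.CardyComplexConeEdgeCoherenceLeeYangClassDefs

/-!
# SKELETON v5 of line `Sketch`, composition `LeeYang` (winding-fugacity / Vitali transfer), crux `EdgeCoherence`
(item stmt-CriticalPhenomena-11385) — lead prover-line-stmt-CriticalPhenomena-11385-c2-0 (continuing c1-0's v4)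

v5 (lead c2, 2026-08-17): the bet `stub_equidistribution` is no longer a stub — it is DERIVED from the new registered
stub `stub_classBalance` (tilted class balance, percolation vocabulary: the four x-tilted class masses
`classGF (Λ δ) δ v c x` agree to `o(Z(x))`) by the landed dictionary `equidistribution_of_classBalance`
(`Theorems/CardyComplexConeEdgeCoherenceLeeYangClassDefs.lean`, p148042). Open stubs: `stub_domination` (bet),
`stub_classBalance` (bet, positive vocabulary; x = 1 case = `Sig.stub_classBalanceOne`, the promotable programme),
`stub_envelope0` (= `EdgePrecompact` (i) summed; blocked on stmt-CriticalPhenomena-11387). Registered sub-goals in flight: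
`medialExploration_rotData` (exact ℤ₄ covariance of the exploration ⇒ `classGF`/`cornerObs` covariance ⇒
EdgeCoherence(u ≡ 1) ⟺ rotational forgetting of the corner observable; class balance ⟸ tilted rotational forgetting).

Vocabulary: `Theorems/CardyComplexConeEdgeCoherenceDefs.lean` (`cornerObs`, `harmonic`, `HarmonicVanishing`,
`startCorner`; composition `FixedRadiusCut`, whose `stub_aliasing : HarmonicVanishing → EdgeCoherence` is LANDED in
`Theorems/CardyComplexConeEdgeCoherenceStubAliasing.lean`, p87880) and `Theorems/CardyComplexConeEdgeCoherenceLeeYangDefs.lean`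
(p137575: `indexGF`, `zeta0`, `logRect`, `arcRegion`, the seven `Sig.stub_*` statements, region lemmas, glue
`envelope0_of_edgePrecompact`).

Composition: `EdgeCoherence ⇐ stub_aliasing ⇐ HarmonicVanishing ⇐ harmonicVanishing_of (stub_laurent, stub_identification,
stub_division, stub_transfer, stub_domination, stub_equidistribution, stub_envelope0)`. Stubs `laurent`, `identification`,
`division`, `transfer` are provable now (workers); `domination`, `equidistribution` are the card's OPEN bets (lead);
`envelope0` is `EdgePrecompact` (i) summed (glue proved; blocked on stmt-CriticalPhenomena-11387).

Sources: idea card `Cruxes/EdgeCoherence/Ideas/lee-yang-winding-fugacity.md`; planner sketch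
`Cruxes/EdgeCoherence/SketchIdeator2.lean` (`FirstLemmaLeeYang`); H. Duminil-Copin, S. Smirnov, Clay Math. Proc. 15 (2012)
§8 Conj. 8.7; Vitali's theorem (tree `Literature/Analysis/Complex/VitaliConvergence.lean`).
-/

noncomputable section

namespace Summit.CriticalPhenomena.CardyFormulaZ2.Cruxes.EdgeCoherence.LeeYang

open scoped BigOperators Topology
open Filter Set MeasureTheory
open Literature.Probability.LatticeModels Literature.Probability.RandomPlanarGeometry
open Literature.Probability.Percolation (BondConfig bondPercolation half)
open Summit.CriticalPhenomena.CardyFormulaZ2.Theses.CardyComplexCone (EdgeCoherence EdgePrecompact)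
open Summit.CriticalPhenomena.CardyFormulaZ2.Cruxes.EdgeCoherence.FixedRadiusCut
  (cornerObs harmonic HarmonicVanishing startCorner)

/-! ## SKELETON of line `Sketch`, composition `LeeYang` — registered stubs and the composition `EdgeCoherence_of`

The seven stubs of the composition are the registered obligations (`ledger skeleton check … --crux stmt-CriticalPhenomena-11385`);
each is proved BY NAME in a helper file `Theorems/CardyComplexConeEdgeCoherenceLeeYang<Stub>.lean`
(`--supports stmt-CriticalPhenomena-11385`). `stub_aliasing : HarmonicVanishing → EdgeCoherence` is LANDED
(`Theorems/CardyComplexConeEdgeCoherenceStubAliasing.lean`, p87880) and imported, not re-registered. -/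

/-! LANDED stubs (imported, proved BY NAME in their helper files): `stub_laurent` (p138037,
`…LeeYangLaurent.lean`), `stub_identification` (p138460, `…LeeYangIdentification.lean`), `stub_division`
(p138771, `…LeeYangDivision.lean`), `stub_transfer` (p138916, `…LeeYangTransfer.lean`). -/

example : Sig.stub_laurent := stub_laurent
example : Sig.stub_identification := stub_identification
example : Sig.stub_division := stub_division
example : Sig.stub_transfer := stub_transfer

/-- Registered stub DOMINATION (OPEN bet `ArcRotatedDomination`; lead). -/
theorem stub_domination : Sig.stub_domination := by
  sorry

/-- Registered stub TILTED CLASS BALANCE (OPEN bet `TiltedClassEquidistribution` in percolation vocabulary; lead):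
for real fugacities `|x − 1| < η` the four `x`-tilted class masses `N_c^{(x)}(v) = classGF (Λ δ) δ v c x` agree to
`ε ‖Z_v(x)‖`, eventually in `δ`, uniformly for `v` over compacts. -/
theorem stub_classBalance : Sig.stub_classBalance := by
  sorry

/-- EQUIDISTRIBUTION (the composition's former stub) — DERIVED from `stub_classBalance` by the landed dictionary
`equidistribution_of_classBalance` (p148042): `Z(x i^k) = Σ_c (i^c/i^{c₀})^k (N_c − N_0)`, `Σ_c i^{kc} = 0`. -/
theorem stub_equidistribution : Sig.stub_equidistribution :=
  equidistribution_of_classBalance stub_classBalance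

/-- Registered stub ENVELOPE of `H₀` (= `EdgePrecompact` (i) summed, `envelope0_of_edgePrecompact`; blocked on
stmt-CriticalPhenomena-11387). -/
theorem stub_envelope0 : Sig.stub_envelope0 := by
  sorry

/-- **The composition, part 1: `HarmonicVanishing`.** Given `(D, Λ, K, ε')`: take `(M, η₁)` from DOMINATION,
`η₂` from EQUIDISTRIBUTION (⇐ CLASS BALANCE), `C` from the ENVELOPE, `η = min η₁ η₂ ½`, and `ε` from TRANSFER at
`(η, max M 0, ε'/max C 1)`. Eventually in `δ` (admissible, dominated, `ε`-equidistributed, enveloped, `δ > 0`), at a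
vertex `v` over `K` and `k ∈ {1,2,3}`: the pair `f = Z(· i^k)`, `g = Z = indexGF (Λ δ) δ v` is holomorphic on `U_η`
(LAURENT), dominated by `max M 0` on `U_η` (polar chart) and by `ε` on the segment, so DIVISION gives `f = h g` with
`‖h‖ ≤ max M 0`, `‖h‖ ≤ ε` on the segment, TRANSFER gives `‖h(ζ₀)‖ ≤ ε'/max C 1`, and IDENTIFICATION turns
`‖f(ζ₀)‖ = ‖h(ζ₀)‖ ‖g(ζ₀)‖` into `‖H_k(v)‖ ≤ (ε'/max C 1) ‖H₀(v)‖ ≤ ε' δ^{1/3}`. -/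
theorem harmonicVanishing_of : HarmonicVanishing := by
  intro D Λ hΩ hδ hadm K hK hKD ε' hε'
  obtain ⟨M, η₁, hη₁, hdom⟩ := stub_domination
  obtain ⟨η₂, hη₂, hequi⟩ := stub_equidistribution
  obtain ⟨C, hC⟩ := stub_envelope0 D Λ hΩ hδ hadm K hK hKD
  set η : ℝ := min (min η₁ η₂) (1 / 2) with hηdef
  have hη0 : 0 < η := lt_min (lt_min hη₁ hη₂) (by norm_num)
  have hηhalf : η ≤ 1 / 2 := min_le_right _ _
  have hηη₁ : η ≤ η₁ := (min_le_left _ _).trans (min_le_left _ _)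
  have hηη₂ : η ≤ η₂ := (min_le_left _ _).trans (min_le_right _ _)
  have hM0 : (0:ℝ) ≤ max M 0 := le_max_right _ _
  have hC1 : (0:ℝ) < max C 1 := lt_of_lt_of_le one_pos (le_max_right _ _)
  obtain ⟨ε, hε, htrans⟩ :=
    stub_transfer η (max M 0) hη0 hηhalf hM0 (ε' / max C 1) (div_pos hε' hC1)
  filter_upwards [hadm, hdom D Λ hΩ hδ hadm K hK hKD, hequi D Λ hΩ hδ hadm K hK hKD ε hε, hC,
    self_mem_nhdsWithin] with δ hadmδ hdomδ hequiδ hCδ hpos v hv k hk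
  have hδ0 : δ ≠ 0 := ne_of_gt hpos
  have hδ3 : (0:ℝ) ≤ δ ^ ((1:ℝ) / 3) := Real.rpow_nonneg (le_of_lt hpos) _
  -- the dominated pair on the region
  set g : ℂ → ℂ := indexGF (Λ δ) δ v with hgdef
  set f : ℂ → ℂ := fun z => indexGF (Λ δ) δ v (z * Complex.I ^ k) with hfdef
  have hZ : DifferentiableOn ℂ g {z : ℂ | z ≠ 0} := stub_laurent (Λ δ) δ v hadmδ
  have hg : DifferentiableOn ℂ g (arcRegion η) := hZ.mono (arcRegion_subset_compl_zero η)
  have hf : DifferentiableOn ℂ f (arcRegion η) := by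
    have hlin : DifferentiableOn ℂ (fun z : ℂ => z * Complex.I ^ k) (arcRegion η) :=
      (differentiable_id.mul_const _).differentiableOn
    refine hZ.comp hlin fun z hz => ?_
    exact mul_ne_zero (ne_zero_of_mem_arcRegion hz) (pow_ne_zero _ Complex.I_ne_zero)
  have hdomU : ∀ z ∈ arcRegion η, ‖f z‖ ≤ max M 0 * ‖g z‖ := by
    intro z hz
    obtain ⟨x, θ, hx, hθ₁, hθ₂, rfl⟩ := (mem_arcRegion_iff hη0 hηhalf).1 hz
    have h := hdomδ v hv x θ (lt_of_lt_of_le hx hηη₁) (by linarith) (lt_of_lt_of_le hθ₂ hηη₁) k hk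
    calc ‖f ((x : ℂ) * Complex.exp ((θ : ℂ) * Complex.I))‖
        ≤ M * ‖g ((x : ℂ) * Complex.exp ((θ : ℂ) * Complex.I))‖ := h
      _ ≤ max M 0 * ‖g ((x : ℂ) * Complex.exp ((θ : ℂ) * Complex.I))‖ := by
          gcongr; exact le_max_left _ _
  have hseg : ∀ x : ℝ, |x - 1| < η → ‖f x‖ ≤ ε * ‖g x‖ :=
    fun x hx => hequiδ v hv x (lt_of_lt_of_le hx hηη₂) k hk
  obtain ⟨h, hh, hfg, hhM, hhε⟩ :=
    stub_division η (max M 0) ε hη0 hηhalf hM0 hε.le f g hf hg hdomU hseg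
  have hζ : ‖h zeta0‖ ≤ ε' / max C 1 := htrans h hh hhM hhε
  -- identification of the harmonics with the rotated values at ζ₀
  have hid : ∀ j : ℕ, ‖harmonic Λ δ j v‖ = ‖indexGF (Λ δ) δ v (zeta0 * Complex.I ^ j)‖ := by
    intro j
    rw [show harmonic Λ δ j v = harmonic (fun _ => Λ δ) δ j v from rfl,
      stub_identification (Λ δ) δ hadmδ hδ0 v j, norm_mul, norm_pow, Complex.norm_I, one_pow, one_mul]
  have hk0 : ‖harmonic Λ δ 0 v‖ = ‖g zeta0‖ := by
    rw [hid 0, pow_zero, mul_one]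
  have hCC : C * δ ^ ((1:ℝ) / 3) ≤ max C 1 * δ ^ ((1:ℝ) / 3) :=
    mul_le_mul_of_nonneg_right (le_max_left _ _) hδ3
  calc ‖harmonic Λ δ k v‖ = ‖f zeta0‖ := hid k
    _ = ‖h zeta0‖ * ‖g zeta0‖ := by rw [hfg zeta0 (zeta0_mem_arcRegion hη0 hηhalf), norm_mul]
    _ ≤ (ε' / max C 1) * (max C 1 * δ ^ ((1:ℝ) / 3)) := by
        refine mul_le_mul hζ ?_ (norm_nonneg _) (div_pos hε' hC1).le
        rw [← hk0]
        exact (hCδ v hv).trans hCC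
    _ = ε' * δ ^ ((1:ℝ) / 3) := by
        field_simp

/-- **The composition: the line closes the crux modulo its registered stubs** — `EdgeCoherence` (by name) from
`HarmonicVanishing` via the LANDED stub `stub_aliasing` (u ≡ 1, exact `ℤ₄` inversion). -/
theorem EdgeCoherence_of : EdgeCoherence :=
  FixedRadiusCut.stub_aliasing harmonicVanishing_of

end Summit.CriticalPhenomena.CardyFormulaZ2.Cruxes.EdgeCoherence.LeeYang

end
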